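import Mathlib
import Literature.MathematicalPhysics.QuantumFieldTheory.Balaban1983to89.B15Eq112Admissible
import Literature.MathematicalPhysics.QuantumFieldTheory.Balaban1983to89.B14BoxFix

/-!
# `Balaban1983to89.B15Eq112Parallelepipeds` — [Balaban1989LargeFieldI] p. 179, the sentence after (1.12)–(1.13):
# **«By the definition all components of the domains Z″_j are also rectangular parallelepipeds for j = h, h + 1, …, k»**
# — PROVED on the ℤᵈ cube carrier for the new large-field regions `Z″_j` of (1.10)–(1.11)
# (`B15Eq112Admissible.Zpp`, all three regimes) from the located input of p. 177 and [Balaban1988Convergent] (2.3)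

statement-level skeleton of published theorems with citation tags; proofs where landed; nothing here is a claim about
the Yang–Mills mass gap.

CITATION HEADER (lean-in-tree rule 2026-08-18).  T. Bałaban, *Large field renormalization. I. The basic step of the 𝐑
operation*, Commun. Math. Phys. **122**, 175–202 (1989), doi:10.1007/BF01257412, bib `Balaban1989LargeFieldI` (cell paper
B15 = [IV]; held `paper:balaban1989-cmp122-large-field-i`, journal page = PDF page + 174: p. 177 = PDF 3, p. 179 = PDF 5,
text layer `p0003.txt` / `p0005.txt` re-read by this seat 2026-08-22).  "[III]" = T. Bałaban, *Convergent renormalization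
expansions for lattice gauge theories*, Commun. Math. Phys. **119**, 243–285 (1988), doi:10.1007/BF01217741, bib
`Balaban1988Convergent` (cell paper B14; p. 251 = PDF 9, p. 255 = PDF 13, p. 269 = PDF 27, text layer re-read).
WHAT IS REPRODUCED: SKELETON row `B15.Eq1.12` (owner r12), its last clause *"components of `Z″_j` rectangular
parallelepipeds"* — the one clause of the (1.10)–(1.12) paragraph left untyped by `B15Eq112Admissible` (its HONEST SCOPE:
*"NOT typed: «By the definition all components of the domains Z″_j are also rectangular parallelepipeds»"*; r12's
`B15-CLOSURE.md` §3: *"LEFT: the parallelepiped clause only"*); cross-reference rows `B15.Eq1.10`, `B15.Eq1.11` (r12),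
`B15.Def§1.i`/`B15.Def§1.ii` (p. 177 (i)/(ii)), `B14.Eq2.3` ([III] (2.3), r11).  Unit `lit-balaban-p29` gen 16 (Phase-2 free
target, G.5-34(d)), HOME `run/shared/lean/pub/lit-balaban/`.  KNITTING — used BY NAME, nothing restated: pv02
`B14DomainGeom.{Pt, Within, cubeIdx, cubeIdx_corner, IsUnionOfCubes, IdxNear, enl, subset_enl, idxNear_of_within}`,
`B14Components.{Touching, TConn, tComp, PConn, pComp, idxNear_one_iff, …}` (the touching reading of «component», [III]
(2.19) p. 258), `B14BoxFix.{ibox, IsBox, ibox_tconn, TConn.mono}` (the (2.3) vocabulary: *"rectangular parallelepiped"*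
= index box), r11 `B14.Eq213MaximalDomains.{side, side_succ, side_pos}`, b02 `B16Stage3Regions.{farZ, Zk, Zk0}`, and p29
g14 `B15Eq112Admissible.{Hypotheses, ClassZ.mem_of_adj, Zpp, zpp_of_le, zpp_of_lt, completion, completion_top,
completion_bot, completion_mid, side_eq_side_mul}`.

THE PRINTED TEXT.  [IV] p. 179 [PDF 5], after (1.12)–(1.13), verbatim: *"By the definition all components of the domains
Z″_j are also rectangular parallelepipeds for j = h, h + 1, …, k."*  The "definition" is (1.10)–(1.11) (same page): *"Define
Z″_k = (Z′_{k−N₀})^{~3} = (Ω^{~5}_{k−N₀+1})ᶜ ∩ Z, Z″_{k−N₀+1} = (Z′_{k−N₀})^~ = (Ω^{~7}_{k−N₀+1})ᶜ ∩ Z, (1.10) and complete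
these two sets to a sequence Z″_k, Z″_{k−1}, …, Z″_{k−N₀+2}, Z″_{k−N₀+1} in such a way that the complements of these sets
form an admissible sequence of domains based on partitions into M-cubes in the corresponding scales. … Next, define
Z″_j = (Ω_j^{~5})ᶜ ∩ Z for j = k − N₀, k − N₀ − 1, …, k − N + 1 = h + 1, Z″_j = Z_j for j = h, h − 1, …, 1. (1.11)"*, with
*"the domains Ω_j^{~n} are unions of L^{−(k−j)}MR_j-cubes of the lattice T_η"*.  The word *"also"* refers to [IV] p. 177
[PDF 3], verbatim: *"we consider the class of components such that each satisfies the following two properties: (i) it is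
contained in a cube of the size 100MR_k, (ii) in the preceding N renormalization steps no new large field regions were
created inside this component, and the previous regions contained in it satisfy the condition (i) on the corresponding
scales. According to our rule of construction of the large field regions, for such a component all the regions connected
with the last N steps are rectangular parallelepipeds. … Let us denote the union of the above class of components by Z"* —
the *"rule of construction"* being [III] p. 251 [PDF 9] *"We distinguish components which are contained in cubes of sizes
smaller than 100LMR₁, and we replace such components by the smallest rectangular parallelepipeds containing them. Such a
rectangular parallelepiped is the smallest convex domain, which is a union of LMR₁-cubes, containing a given component"*
(repeated at every step, p. 269 [PDF 27]) with the inductive condition [III] (2.3) p. 255 [PDF 13] *"if a component of Z_j is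
contained in a cube of the size 100MR_j (in the L^{−j}-lattice), then it is a rectangular parallelepiped"* (pv02's
`B14BoxFix.Cond23`; the R-flow *"in some steps the number R_k decreases by the factor L⁻¹"*, [IV] p. 177, and *"R_j is the
smallest number of the form Lʳ …"*, [III] (2.5) p. 255).

THE DICTIONARY (= `B15Eq112Admissible`'s).  Sites `Pt d = ℤᵈ` (the finest lattice `T_η`, η = 1 lattice unit, on the
universal cover; everything is local); the M-cubes of scale `j` have side `s_j = side L M j = LʲM`, the `L^{−(k−j)}MR_j`-cubes
side `s_j·R_j`; `X^{~n}` = `enl t n X`; `Z″_j = Zpp L M k₀ R Ω E Z j` with `E = completion L M k₀ k (Ω (k₀+1)) Z` the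
constructed completion of (1.10) (`k₀ = k − N₀`, `h = k − N`).  *"Component"* = touching-component of sites through their
`t`-cubes (pv02 `pComp t`, corners included — the reading of record for components of large-field regions, cell GAPS
C-adv5-15); *"rectangular parallelepiped"* (of `t`-cubes) = `cubeBox t lo hi` = the sites whose cube index lies in pv02's
index box `ibox lo hi`; *"all components of X are rectangular parallelepipeds"* = `BoxComponents t X` (§1).

WHAT THIS FILE PROVES (kernel-checked, zero `sorry`, axioms standard; six definitions WITH BODIES — `idx`, `corner`,
`cubeBox`, `IsCubeBox`, `BoxComponents`, `shrinkIdx` —, no structure, no named fact; §7's instance data are `private def`s).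
§1–§2 dictionary site components ↔ cube-index components for unions of cubes (`pconn_iff_tconn`, `tComp_idx_of_pComp`,
   `pComp_of_tComp_idx`, `pconn_cubeBox`).
§3 **THE INDEX-LEVEL CORE** `tComp_shrinkIdx`: if the touching-component of `c` in `K` is the box `[lo, hi]`, every index
   outside `K` touching `K` lies in `KY`, and `KY ∩ K = ∅`, then in `K` minus the indices within sup-distance `n` of `KY` the
   component of (a surviving) `c` is EXACTLY the inner box `[lo + n, hi − n]` (`mem_shrinkIdx_iff_inner`: the cube just
   outside a face of the box is in `KY`).
§4 **THE SITE-LEVEL CORE** `boxComponents_diff_enl` / `pComp_diff_enl`: `X` with box components of `t`-cubes, `Y ∩ X = ∅`,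
   `Y` meeting every `t`-cube outside `X` that touches a cube of `X` ⟹ `X ∖ Y^{~n}` has box components (the inner boxes);
   `boxComponents_diff_enl_compl`: the case `Y = Xᶜ` (removing `n` layers of `X` itself) needs nothing.
§5 refinement of the cube scale (`BoxComponents.of_mul`: boxes of `t·m`-cubes are boxes of `t`-cubes with the same
   components; `cubeBox_mul`, `idxNear_mul`).
§6 **THE PRINTED CLAUSE**, `boxComponents_zpp`: under `B15Eq112Admissible.Hypotheses L M h k₀ k R Ω Z` and the two located
   inputs `hbox` (p. 177: for `h < j ≤ k₀ + 1` every component of the old region `Ω_jᶜ ∩ Z` inside the class `Z` is a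
   rectangular parallelepiped of `L^{−(k−j)}MR_j`-cubes) and `hRstep` (`R_j ∣ L·R_{j+1}`, [III] (2.5) + p. 177), EVERY
   `Z″_j`, `h < j ≤ k`, has all its components rectangular parallelepipeds of the M-cubes `s_j` of its scale — regime by
   regime: `boxComponents_zpp_mid` (`h < j ≤ k₀`, `Z″_j = (Ω_j^{~5})ᶜ ∩ Z`, boxes of the `R`-cubes `s_jR_j` themselves,
   `boxComponents_zpp_Rcubes`; the surrounding hypothesis of §4 is `adj_idx_compl_inter` — a cube outside `Ω_jᶜ ∩ Z` touching it
   meets `Ω_j`, by the p. 177 collar `ClassZ.mem_of_adj` and `Ω_k ⊆ Ω_j`), `boxComponents_farZ_top` (the two members of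
   (1.10)), `boxComponents_zpp_high` (the constructed completion: `Z″_j = Z″_{j+1}` minus one layer of `s_{j+1}`-cubes,
   descending induction + refinement `s_{j+1} = L·s_j`); dictionary to pv02's (2.3) vocabulary `BoxComponents.isBox_tComp`.
§7 a `d = 1` instance of ALL hypotheses of §6 jointly (`Hypotheses` ∧ `hbox` ∧ `hRstep`; `h = 0`, `k₀ = 2`, `k = 4`) with
   `Z ≠ ∅` and a non-empty middle-regime `Z″₁`, and the theorem applied to it (non-vacuity in all three regimes).
HONEST SCOPE.  Set geometry only; nothing analytic.  (a) The member `j = h` of the printed sentence (`Z″_h = Z_h`, an OLD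
large-field region) is the p. 177 input itself and is not a value of `B15Eq112Admissible.Zpp` (which types (1.11) above `h`
only) — not re-asserted here.  (b) The input `hbox` is stated for the traces `Ω_jᶜ ∩ Z` of the old DOMAINS `Ω_j` on the class
`Z` (these are what (1.10)–(1.11) use), `h < j ≤ k₀ + 1`; p. 177 prints it for *"all the regions connected with the last N
steps"* inside such components — we read `Ω_jᶜ ∩ Z` as one of them ([III] (2.1) `Ω_j ⊃ Λ_j ⊃ Ω_{j+1}`, (3.5)); deriving
`hbox` from [III]'s construction (3.5)/(3.20) + the replacement rule + (i)/(ii) step by step is NOT done here (pv02's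
`B14BoxFix` certifies the rule ↦ (2.3) at a fixpoint and that a single pass does not give (2.3); `B15Claim177` certifies
boxes ↦ boxes under the region-building operations of the index model).  (c) `hRstep` reads the R-flow as `R_j ∣ L·R_{j+1}`
(powers of `L`, ratio `1` or `L`); it is used only to make the `L^{−(k−j)}MR_j`-cubes nest into the `MR_k`-cubes of `Z`.
(d) Which completion print takes is not fixed (*"in such a way that"*); the clause is proved for the constructed (thinnest)
completion of `B15Eq112Admissible` §4 — for an arbitrary `IsCompletion` it is false in general (a completion may remove
non-box-shaped layers).  (e) Components are pv02's touching-components (corners included); for unions of boxes pairwise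
non-touching this agrees with every finer reading.  NOT summit progress.
-/

namespace Literature.MathematicalPhysics.QuantumFieldTheory.Balaban1983to89.B15Eq112Parallelepipeds

open Literature.MathematicalPhysics.QuantumFieldTheory.Balaban1983to89
open B14DomainGeom B14.Eq213MaximalDomains B16Stage3Regions B14Components B14BoxFix B15Eq112Admissible

variable {d : ℕ}

/-! ## §1. Cube indices of a region, boxes of cubes, «all components are rectangular parallelepipeds» -/

/-- The set of indices of the side-`t` cubes MEETING `X` (for a union of `t`-cubes: of the cubes it consists of).
[folklore] -/
def idx (t : ℕ) (X : Set (Pt d)) : Set (Pt d) := {c | ∃ x ∈ X, cubeIdx t x = c}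

/-- The lower corner `t·c` of the cube of index `c`. [folklore] -/
def corner (t : ℕ) (c : Pt d) : Pt d := fun i => (t : ℤ) * c i

/-- **A rectangular parallelepiped of side-`t` cubes**: the sites whose `t`-cube index lies in the index box `lo ≤ c ≤ hi`
(pv02's `B14BoxFix.ibox`; [III] p. 251 *"Such a rectangular parallelepiped is the smallest convex domain, which is a
union of LMR₁-cubes, containing a given component"*). [cite: Balaban1988Convergent, p.251] -/
def cubeBox (t : ℕ) (lo hi : Pt d) : Set (Pt d) := {x | cubeIdx t x ∈ ibox lo hi}

/-- `B` *"is a rectangular parallelepiped"* (of `t`-cubes). [cite: Balaban1988Convergent, (2.3) p.255] -/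
def IsCubeBox (t : ℕ) (B : Set (Pt d)) : Prop := ∃ lo hi : Pt d, B = cubeBox t lo hi

/-- **«all components of the domain are rectangular parallelepipeds»** (of side-`t` cubes): `X` is a union of `t`-cubes and
the touching-component (pv02's `B14Components.pComp`, the *"component"* reading of [III] (2.19) p. 258) of every site of
`X` is a box of `t`-cubes. [cite: Balaban1989LargeFieldI, p.179; Balaban1988Convergent, (2.3) p.255] -/
def BoxComponents (t : ℕ) (X : Set (Pt d)) : Prop := IsUnionOfCubes t X ∧ ∀ a ∈ X, IsCubeBox t (pComp t X a)

/-- [folklore] -/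
private theorem cubeIdx_corner' {t : ℕ} (ht : 0 < t) (c : Pt d) : cubeIdx t (corner t c) = c := cubeIdx_corner t ht c

/-- [folklore] -/
private theorem mem_idx_of_mem {t : ℕ} {X : Set (Pt d)} {x : Pt d} (hx : x ∈ X) : cubeIdx t x ∈ idx t X := ⟨x, hx, rfl⟩

/-- For a union of `t`-cubes, a site belongs to `X` iff its cube index belongs to `idx t X`. [folklore] -/
private theorem mem_iff_cubeIdx_mem_idx {t : ℕ} {X : Set (Pt d)} (hX : IsUnionOfCubes t X) (x : Pt d) :
    x ∈ X ↔ cubeIdx t x ∈ idx t X := by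
  refine ⟨mem_idx_of_mem, ?_⟩
  rintro ⟨y, hy, hyx⟩
  exact (hX y x hyx).mp hy

/-- For a union of `t`-cubes (`t ≥ 1`), the corner of an index of `idx t X` lies in `X`. [folklore] -/
private theorem corner_mem_of_mem_idx {t : ℕ} (ht : 0 < t) {X : Set (Pt d)} (hX : IsUnionOfCubes t X) {c : Pt d}
    (hc : c ∈ idx t X) : corner t c ∈ X := by
  rw [mem_iff_cubeIdx_mem_idx hX, cubeIdx_corner' ht]
  exact hc

/-- A box of cubes is a union of cubes. [folklore] -/
private theorem isUnionOfCubes_cubeBox (t : ℕ) (lo hi : Pt d) : IsUnionOfCubes t (cubeBox t lo hi) := by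
  intro x y hxy
  simp only [cubeBox, Set.mem_setOf_eq, hxy]

/-- The index set of a box of `t`-cubes (`t ≥ 1`) is the index box. [folklore] -/
private theorem idx_cubeBox {t : ℕ} (ht : 0 < t) (lo hi : Pt d) : idx t (cubeBox t lo hi) = ibox lo hi := by
  ext c
  constructor
  · rintro ⟨x, hx, rfl⟩
    exact hx
  · intro hc
    exact ⟨corner t c, by simpa [cubeBox, cubeIdx_corner' ht] using hc, cubeIdx_corner' ht c⟩

/-! ## §2. Site components versus cube-index components -/

/-- Site chains survive enlarging the ambient set. [folklore] -/
private theorem PConn.mono' {t : ℕ} {X X' : Set (Pt d)} (h : X ⊆ X') {a b : Pt d} (hab : PConn t X a b) : PConn t X' a b := by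
  induction hab with
  | refl => exact Relation.ReflTransGen.refl
  | tail _ hstep ih => exact Relation.ReflTransGen.tail ih ⟨h hstep.1, h hstep.2.1, hstep.2.2⟩

/-- **Dictionary** (any `X`, `a ∈ X`): the site `y` lies in the touching-component of `a` in `X` iff `y ∈ X` and the cube index
of `y` lies in the touching-component of the cube index of `a` in `idx t X` (chains of sites ↔ chains of cubes meeting `X`):
the *"connected components"* ([III] (2.19)) of a region that is a union of cubes, read on sites or on cubes alike.
[cite: Balaban1988Convergent, (2.19) p.258] -/
theorem pconn_iff_tconn {t : ℕ} {X : Set (Pt d)} {a : Pt d} (ha : a ∈ X) (y : Pt d) :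
    PConn t X a y ↔ y ∈ X ∧ TConn (idx t X) (cubeIdx t a) (cubeIdx t y) := by
  constructor
  · intro h
    induction h with
    | refl => exact ⟨ha, Relation.ReflTransGen.refl⟩
    | @tail b c _ hstep ih =>
      refine ⟨hstep.2.1, Relation.ReflTransGen.tail ih.2 ⟨mem_idx_of_mem hstep.1, mem_idx_of_mem hstep.2.1, ?_⟩⟩
      exact (idxNear_one_iff t b c).mp hstep.2.2
  · rintro ⟨hy, h⟩
    -- induction over the index chain, carrying an arbitrary site of the current cube
    suffices key : ∀ c, TConn (idx t X) (cubeIdx t a) c → ∀ z ∈ X, cubeIdx t z = c → PConn t X a z from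
      key _ h y hy rfl
    intro c hc
    induction hc with
    | refl =>
      intro z hz hzc
      exact Relation.ReflTransGen.single ⟨ha, hz, fun i => by rw [hzc]; simp⟩
    | @tail b c _ hstep ih =>
      intro z hz hzc
      obtain ⟨w, hw, hwb⟩ := hstep.1
      have h1 : PConn t X a w := ih w hw hwb
      refine Relation.ReflTransGen.tail h1 ⟨hw, hz, ?_⟩
      rw [idxNear_one_iff, hwb, hzc]
      exact hstep.2.2

/-- If the site component of `a ∈ X` (a union of `t`-cubes, `t ≥ 1`) is the box of cubes `[lo, hi]`, then the index component of
the cube of `a` in `idx t X` is the index box `[lo, hi]` (components on sites ↔ on cubes, [III] (2.19)).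
[cite: Balaban1988Convergent, (2.19) p.258] -/
theorem tComp_idx_of_pComp {t : ℕ} (ht : 0 < t) {X : Set (Pt d)} {a : Pt d} (ha : a ∈ X)
    {lo hi : Pt d} (h : pComp t X a = cubeBox t lo hi) : tComp (idx t X) (cubeIdx t a) = ibox lo hi := by
  ext c
  constructor
  · intro hc
    have hcK : c ∈ idx t X := TConn.mem_right (mem_idx_of_mem ha) hc
    obtain ⟨z, hz, rfl⟩ := hcK
    have : z ∈ pComp t X a := (pconn_iff_tconn ha z).mpr ⟨hz, hc⟩
    rw [h] at this
    exact this
  · intro hc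
    have hz : corner t c ∈ cubeBox t lo hi := by simpa [cubeBox, cubeIdx_corner' ht] using hc
    rw [← h] at hz
    have := ((pconn_iff_tconn ha _).mp hz).2
    rwa [cubeIdx_corner' ht] at this

/-- Conversely: if the index component of the cube of `a ∈ X` (a union of `t`-cubes) is the index box `[lo, hi]`, then the site
component of `a` is the box of cubes `[lo, hi]` (components on sites ↔ on cubes, [III] (2.19)).
[cite: Balaban1988Convergent, (2.19) p.258] -/
theorem pComp_of_tComp_idx {t : ℕ} {X : Set (Pt d)} (hX : IsUnionOfCubes t X) {a : Pt d} (ha : a ∈ X) {lo hi : Pt d}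
    (h : tComp (idx t X) (cubeIdx t a) = ibox lo hi) : pComp t X a = cubeBox t lo hi := by
  ext y
  constructor
  · intro hy
    have := ((pconn_iff_tconn ha y).mp hy).2
    show cubeIdx t y ∈ ibox lo hi
    rw [← h]
    exact this
  · intro hy
    have hy' : cubeIdx t y ∈ tComp (idx t X) (cubeIdx t a) := by rw [h]; exact hy
    have hyK : cubeIdx t y ∈ idx t X := tComp_subset (mem_idx_of_mem ha) hy'
    have hyX : y ∈ X := (mem_iff_cubeIdx_mem_idx hX y).mpr hyK
    exact (pconn_iff_tconn ha y).mpr ⟨hyX, hy'⟩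

/-- A box of `t`-cubes is touching-connected at site level: any two of its sites are joined inside it (*"Such a rectangular
parallelepiped is the smallest convex domain, which is a union of … cubes"* — in particular ONE component).
[cite: Balaban1988Convergent, p.251] -/
theorem pconn_cubeBox {t : ℕ} (ht : 0 < t) {lo hi x y : Pt d} (hx : x ∈ cubeBox t lo hi) (hy : y ∈ cubeBox t lo hi) :
    PConn t (cubeBox t lo hi) x y := by
  refine (pconn_iff_tconn hx y).mpr ⟨hy, ?_⟩
  rw [idx_cubeBox ht]
  exact ibox_tconn hx hy

/-! ## §3. The index-level core: shrinking a union of box components by `n` cube layers of a surrounding set -/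

/-- The indices of `K` at sup-distance `> n` from every index of `KY` (the cubes of `X` surviving the removal of the
`n`-layer enlargement of `Y`). [folklore] -/
def shrinkIdx (n : ℕ) (K KY : Set (Pt d)) : Set (Pt d) := {c | c ∈ K ∧ ∀ c' ∈ KY, ¬ Within (n : ℤ) c c'}

/-- [folklore] -/
private theorem shrinkIdx_subset (n : ℕ) (K KY : Set (Pt d)) : shrinkIdx n K KY ⊆ K := fun _ hc => hc.1

/-- **Key step.**  Let the touching-component `B = [lo, hi]` of `c₁` in `K` be an index box, let every index outside `K` touching
`K` belong to `KY`, and `KY ∩ K = ∅`.  Then `c₁` survives the `n`-shrinking iff it lies in the inner box `[lo + n, hi − n]`: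
the cube just outside a face of `B` is not in `K` (it would join the component), hence in `KY`, at distance `≤ n` from every
cube of `B` closer than `n` to that face; conversely an index of `KY` within `n` of an inner cube would lie in `B ⊆ K`.  This is
the mechanism of p. 179's *"By the definition"*: the operations `(Ω^{~n})ᶜ ∩ Z` of (1.10)–(1.11) act on a box component as
removal of `n` outer layers. [cite: Balaban1989LargeFieldI, (1.10)–(1.11) p.179] -/
theorem mem_shrinkIdx_iff_inner {n : ℕ} {K KY : Set (Pt d)} (hKY : ∀ c ∈ KY, c ∉ K)
    (hadj : ∀ c, c ∉ K → (∃ c₀ ∈ K, Touching c c₀) → c ∈ KY) {c : Pt d} (hcK : c ∈ K) {lo hi : Pt d}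
    (hB : tComp K c = ibox lo hi) {c₁ : Pt d} (hc₁ : c₁ ∈ ibox lo hi) :
    c₁ ∈ shrinkIdx n K KY ↔ ∀ i, lo i + n ≤ c₁ i ∧ c₁ i ≤ hi i - n := by
  have hBK : ibox lo hi ⊆ K := by rw [← hB]; exact tComp_subset hcK
  have hc₁B : c₁ ∈ tComp K c := by rw [hB]; exact hc₁
  constructor
  · intro hsh i
    by_contra hbad
    rw [not_and_or, not_le, not_le] at hbad
    -- the offending face: `lo i` side or `hi i` side
    rcases hbad with hlo | hhi
    · -- cube just below the `lo i` face, in the column of `c₁`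
      set c'' : Pt d := Function.update c₁ i (lo i) with hc''
      set c' : Pt d := Function.update c₁ i (lo i - 1) with hc'
      have hc''B : c'' ∈ ibox lo hi := by
        intro j
        by_cases hji : j = i
        · subst hji; simp only [hc'', Function.update_self]; exact ⟨le_rfl, by have := hc₁ j; omega⟩
        · simp only [hc'', Function.update_of_ne hji]; exact hc₁ j
      have htouch : Touching c' c'' := by
        intro j
        by_cases hji : j = i
        · subst hji; simp [hc', hc'']
        · simp [hc', hc'', Function.update_of_ne hji]
      have hc'K : c' ∉ K := by
        intro h'
        have : c' ∈ tComp K c := by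
          have h1 : TConn K c c'' := by have := hc''B; rw [← hB] at this; exact this
          exact Relation.ReflTransGen.tail h1 ⟨hBK hc''B, h', htouch.symm⟩
        rw [hB] at this
        have := (this i).1
        simp [hc'] at this
      have hc'Y : c' ∈ KY := hadj c' hc'K ⟨c'', hBK hc''B, htouch⟩
      apply hsh.2 c' hc'Y
      intro j
      by_cases hji : j = i
      · subst hji
        simp only [hc', Function.update_self]
        have := (hc₁ j).1
        rw [abs_of_nonneg (by omega)]
        omega
      · simp [hc', Function.update_of_ne hji]
    · -- cube just above the `hi i` face
      set c'' : Pt d := Function.update c₁ i (hi i) with hc''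
      set c' : Pt d := Function.update c₁ i (hi i + 1) with hc'
      have hc''B : c'' ∈ ibox lo hi := by
        intro j
        by_cases hji : j = i
        · subst hji; simp only [hc'', Function.update_self]; exact ⟨by have := hc₁ j; omega, le_rfl⟩
        · simp only [hc'', Function.update_of_ne hji]; exact hc₁ j
      have htouch : Touching c' c'' := by
        intro j
        by_cases hji : j = i
        · subst hji; simp [hc', hc'']
        · simp [hc', hc'', Function.update_of_ne hji]
      have hc'K : c' ∉ K := by
        intro h'
        have : c' ∈ tComp K c := by
          have h1 : TConn K c c'' := by have := hc''B; rw [← hB] at this; exact this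
          exact Relation.ReflTransGen.tail h1 ⟨hBK hc''B, h', htouch.symm⟩
        rw [hB] at this
        have := (this i).2
        simp [hc'] at this
      have hc'Y : c' ∈ KY := hadj c' hc'K ⟨c'', hBK hc''B, htouch⟩
      apply hsh.2 c' hc'Y
      intro j
      by_cases hji : j = i
      · subst hji
        simp only [hc', Function.update_self]
        have := (hc₁ j).2
        rw [abs_of_nonpos (by omega)]
        omega
      · simp [hc', Function.update_of_ne hji]
  · intro hin
    refine ⟨hBK hc₁, fun c' hc'Y hw => hKY c' hc'Y (hBK ?_)⟩
    intro i
    have h1 := hw i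
    have h2 := hin i
    rw [abs_le] at h1
    constructor <;> omega

/-- **THE INDEX-LEVEL CORE.**  Under the hypotheses of `mem_shrinkIdx_iff_inner`, the touching-component of a surviving
index `c` in the shrunk index set IS the inner box `[lo + n, hi − n]` of the component box `[lo, hi]` of `c` in `K` —
boxes are touching-connected (pv02 `B14BoxFix.ibox_tconn`), and chains in the shrunk set stay in the old component
(mechanism of p. 179 *"By the definition all components … are also rectangular parallelepipeds"*).
[cite: Balaban1989LargeFieldI, (1.10)–(1.11) p.179] -/
theorem tComp_shrinkIdx {n : ℕ} {K KY : Set (Pt d)} (hKY : ∀ c ∈ KY, c ∉ K)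
    (hadj : ∀ c, c ∉ K → (∃ c₀ ∈ K, Touching c c₀) → c ∈ KY) {c : Pt d} (hc : c ∈ shrinkIdx n K KY) {lo hi : Pt d}
    (hB : tComp K c = ibox lo hi) :
    tComp (shrinkIdx n K KY) c = ibox (fun i => lo i + n) (fun i => hi i - n) := by
  have hcK : c ∈ K := hc.1
  have hcB : c ∈ ibox lo hi := by rw [← hB]; exact mem_tComp_self K c
  have key := fun c₁ (h₁ : c₁ ∈ ibox lo hi) => mem_shrinkIdx_iff_inner (n := n) hKY hadj hcK hB h₁
  ext c₂
  constructor
  · intro h2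
    have h2K : TConn K c c₂ := TConn.mono (shrinkIdx_subset n K KY) h2
    have h2B : c₂ ∈ ibox lo hi := by rw [← hB]; exact h2K
    have h2S : c₂ ∈ shrinkIdx n K KY := TConn.mem_right hc h2
    exact (key c₂ h2B).mp h2S
  · intro h2
    have hinner_sub : ibox (fun i => lo i + n) (fun i => hi i - n) ⊆ shrinkIdx n K KY := by
      intro c₁ h₁
      have h₁B : c₁ ∈ ibox lo hi := fun i => by have := h₁ i; simp only at this; constructor <;> omega
      exact (key c₁ h₁B).mpr h₁
    have hcin : c ∈ ibox (fun i => lo i + n) (fun i => hi i - n) := (key c hcB).mp hc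
    exact TConn.mono hinner_sub (ibox_tconn hcin h2)

/-! ## §4. The site-level core: `X ∖ Y^{~n}` has box components when `X` has and `Y` surrounds `X` -/

/-- The cube indices of `X ∖ Y^{~n}` are the `n`-shrunk indices of `X` by the indices of `Y`. [folklore] -/
private theorem idx_diff_enl {t n : ℕ} (X Y : Set (Pt d)) : idx t (X \ enl t n Y) = shrinkIdx n (idx t X) (idx t Y) := by
  ext c
  constructor
  · rintro ⟨x, ⟨hxX, hxE⟩, rfl⟩
    refine ⟨⟨x, hxX, rfl⟩, ?_⟩
    rintro c' ⟨y, hy, rfl⟩ hw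
    exact hxE ⟨y, hy, fun i => by simpa using hw i⟩
  · rintro ⟨⟨x, hxX, rfl⟩, hfar⟩
    refine ⟨x, ⟨hxX, ?_⟩, rfl⟩
    rintro ⟨y, hy, hn⟩
    exact hfar (cubeIdx t y) ⟨y, hy, rfl⟩ (fun i => by simpa using hn i)

/-- `X ∖ Y^{~n}` is a union of `t`-cubes if `X` is. [folklore] -/
private theorem isUnionOfCubes_diff_enl {t n : ℕ} {X : Set (Pt d)} (hX : IsUnionOfCubes t X) (Y : Set (Pt d)) :
    IsUnionOfCubes t (X \ enl t n Y) := by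
  intro x y hxy
  simp only [Set.mem_sdiff, hX x y hxy, enl, Set.mem_setOf_eq, IdxNear, hxy]

/-- **THE SITE-LEVEL CORE, explicit form.**  `X` a union of `t`-cubes (`t ≥ 1`) whose component of `a` is the box `[lo, hi]`;
`Y` disjoint from `X` and meeting every `t`-cube outside `X` that touches a cube of `X`.  Then the component of `a` in
`X ∖ Y^{~n}` (if `a` survives) is the inner box `[lo + n, hi − n]` — the operation `(Ω^{~n})ᶜ ∩ Z` of (1.10)–(1.11) on one
component. [cite: Balaban1989LargeFieldI, (1.10)–(1.11) p.179] -/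
theorem pComp_diff_enl {t n : ℕ} (ht : 0 < t) {X Y : Set (Pt d)} (hX : IsUnionOfCubes t X) (hYX : Disjoint Y X)
    (hadj : ∀ c, c ∉ idx t X → (∃ c₀ ∈ idx t X, Touching c c₀) → c ∈ idx t Y) {a : Pt d} (ha : a ∈ X \ enl t n Y)
    {lo hi : Pt d} (hBox : pComp t X a = cubeBox t lo hi) :
    pComp t (X \ enl t n Y) a = cubeBox t (fun i => lo i + n) (fun i => hi i - n) := by
  have hKY : ∀ c ∈ idx t Y, c ∉ idx t X := by
    rintro c ⟨y, hy, rfl⟩ hcX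
    exact Set.disjoint_left.mp hYX hy ((mem_iff_cubeIdx_mem_idx hX y).mpr hcX)
  have hB : tComp (idx t X) (cubeIdx t a) = ibox lo hi := tComp_idx_of_pComp ht ha.1 hBox
  have hc : cubeIdx t a ∈ shrinkIdx n (idx t X) (idx t Y) := by rw [← idx_diff_enl]; exact mem_idx_of_mem ha
  have hcore := tComp_shrinkIdx hKY hadj hc hB
  rw [← idx_diff_enl] at hcore
  exact pComp_of_tComp_idx (isUnionOfCubes_diff_enl hX Y) ha hcore

/-- **THE SITE-LEVEL CORE.**  If all components of `X` are boxes of `t`-cubes (`t ≥ 1`), `Y ∩ X = ∅` and `Y` meets every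
`t`-cube outside `X` touching a cube of `X`, then all components of `X ∖ Y^{~n}` are boxes of `t`-cubes — the operations of
(1.10)–(1.11) preserve *"all components … rectangular parallelepipeds"*. [cite: Balaban1989LargeFieldI, (1.10)–(1.11) p.179] -/
theorem boxComponents_diff_enl {t n : ℕ} (ht : 0 < t) {X Y : Set (Pt d)} (hX : BoxComponents t X) (hYX : Disjoint Y X)
    (hadj : ∀ c, c ∉ idx t X → (∃ c₀ ∈ idx t X, Touching c c₀) → c ∈ idx t Y) :
    BoxComponents t (X \ enl t n Y) := by
  refine ⟨isUnionOfCubes_diff_enl hX.1 Y, fun a ha => ?_⟩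
  obtain ⟨lo, hi, hBox⟩ := hX.2 a ha.1
  exact ⟨_, _, pComp_diff_enl ht hX.1 hYX hadj ha hBox⟩

/-- The case `Y = Xᶜ`, one or more layers: `X^{~−n} = X ∖ (Xᶜ)^{~n}` (pv02's `innerN`) has box components if `X` has —
the surrounding hypothesis is automatic (the completion steps of (1.10): *"separated by one layer of M-cubes … and so on"*).
[cite: Balaban1989LargeFieldI, (1.10) p.179] -/
theorem boxComponents_diff_enl_compl {t n : ℕ} (ht : 0 < t) {X : Set (Pt d)} (hX : BoxComponents t X) :
    BoxComponents t (X \ enl t n Xᶜ) := by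
  refine boxComponents_diff_enl ht hX disjoint_compl_left fun c hc _ => ?_
  refine ⟨corner t c, ?_, cubeIdx_corner' ht c⟩
  intro h
  exact hc ⟨corner t c, h, cubeIdx_corner' ht c⟩

/-! ## §5. Refinement of the cube scale: boxes of `t·m`-cubes are boxes of `t`-cubes, with the same components -/

/-- Floor division by `m ≥ 1` is `1`-Lipschitz for the sup-distance bound `n`. [folklore] -/
private theorem abs_ediv_sub_ediv_le {a b m : ℤ} (hm : 0 < m) {n : ℕ} (h : |a - b| ≤ n) : |a / m - b / m| ≤ n := by
  rw [abs_le] at h ⊢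
  have h1 : ∀ x y : ℤ, x ≤ y + n → x / m ≤ y / m + n := by
    intro x y hxy
    calc x / m ≤ (y + n * m) / m := Int.ediv_le_ediv hm (by nlinarith)
      _ = y / m + n := by rw [Int.add_mul_ediv_right _ _ hm.ne']
  constructor
  · have := h1 b a (by omega); omega
  · have := h1 a b (by omega); omega

/-- Coarsening the cubes preserves index-nearness: `IdxNear t n ⇒ IdxNear (t·m) n` (`t, m ≥ 1`). [folklore] -/
private theorem idxNear_mul {t m n : ℕ} (hm : 0 < m) {x y : Pt d} (h : IdxNear t n x y) : IdxNear (t * m) n x y := by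
  intro i
  have e : ∀ z : Pt d, cubeIdx (t * m) z i = cubeIdx t z i / (m : ℤ) := by
    intro z
    simp only [cubeIdx]
    push_cast
    rw [Int.ediv_ediv_of_nonneg (Int.natCast_nonneg t)]
  rw [e, e]
  exact abs_ediv_sub_ediv_le (by exact_mod_cast hm) (h i)

/-- A box of `t·m`-cubes is a box of `t`-cubes (`m ≥ 1`): `[lo, hi]` ↦ `[m·lo, m·hi + (m − 1)]` (the partitions into
`LⁿξM₁`-cubes are nested, [III] (2.13); p. 265 *"This partition is compatible with all the other partitions"*).
[cite: Balaban1988Convergent, (2.13) p.256] -/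
theorem cubeBox_mul {t m : ℕ} (hm : 0 < m) (lo hi : Pt d) :
    cubeBox (t * m) lo hi = cubeBox t (fun i => (m : ℤ) * lo i) (fun i => (m : ℤ) * hi i + (m - 1)) := by
  have hm' : (0 : ℤ) < m := by exact_mod_cast hm
  ext x
  simp only [cubeBox, ibox, Set.mem_setOf_eq, cubeIdx]
  push_cast
  refine forall_congr' fun i => ?_
  rw [← Int.ediv_ediv_of_nonneg (Int.natCast_nonneg t)]
  set a : ℤ := x i / (t : ℤ)
  rw [Int.le_ediv_iff_mul_le hm', show a / (m : ℤ) ≤ hi i ↔ a / (m : ℤ) < hi i + 1 from Int.lt_add_one_iff.symm,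
    Int.ediv_lt_iff_lt_mul hm']
  constructor <;> rintro ⟨h1, h2⟩ <;> constructor <;> nlinarith

/-- **Refinement.**  If all components of `X` are boxes of `t·m`-cubes (`t, m ≥ 1`), then all components of `X` for the
finer `t`-cubes are boxes of `t`-cubes (and they are the same sets) — nested compatible partitions, [III] (2.13).
[cite: Balaban1988Convergent, (2.13) p.256] -/
theorem BoxComponents.of_mul {t m : ℕ} (ht : 0 < t) (hm : 0 < m) {X : Set (Pt d)} (hX : BoxComponents (t * m) X) :
    BoxComponents t X := by
  have hcubes : IsUnionOfCubes t X := by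
    intro x y hxy
    apply hX.1
    funext i
    simp only [cubeIdx]
    push_cast
    rw [← Int.ediv_ediv_of_nonneg (Int.natCast_nonneg t), ← Int.ediv_ediv_of_nonneg (Int.natCast_nonneg t)]
    exact congrArg (· / (m : ℤ)) (congrFun hxy i)
  refine ⟨hcubes, fun a ha => ?_⟩
  obtain ⟨lo, hi, hBox⟩ := hX.2 a ha
  refine ⟨fun i => (m : ℤ) * lo i, fun i => (m : ℤ) * hi i + (m - 1), ?_⟩
  rw [← cubeBox_mul hm lo hi]
  ext y
  constructor
  · -- a `t`-chain is a `t·m`-chain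
    intro hy
    rw [← hBox]
    induction hy with
    | refl => exact mem_pComp_self _ X a
    | tail _ hstep ih => exact Relation.ReflTransGen.tail ih ⟨hstep.1, hstep.2.1, idxNear_mul hm hstep.2.2⟩
  · -- the box is `t`-connected inside `X`
    intro hy
    have haB : a ∈ cubeBox (t * m) lo hi := by rw [← hBox]; exact mem_pComp_self _ X a
    have hBX : cubeBox (t * m) lo hi ⊆ X := by rw [← hBox]; exact pComp_subset ha
    rw [cubeBox_mul hm] at hy haB hBX
    exact PConn.mono' hBX (pconn_cubeBox ht haB hy)

/-! ## §6. [IV] p. 179: «all components of the domains Z″_j are rectangular parallelepipeds» — for `B15Eq112Admissible.Zpp` -/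

section Main

variable {L M h k₀ k : ℕ} {R : ℕ → ℕ} {Ω : ℕ → Set (Pt d)} {Z : Set (Pt d)}

/-- `farZ t n Ω Z = ((Ωᶜ ∩ Z) ∖ Ω^{~n})` (the `n`-layer enlargement contains `Ω`). [folklore] -/
private theorem farZ_eq_diff (t n : ℕ) (Ω Z : Set (Pt d)) : farZ t n Ω Z = (Ωᶜ ∩ Z) \ enl t n Ω := by
  ext x
  simp only [farZ, Set.mem_inter_iff, Set.mem_compl_iff, Set.mem_sdiff]
  constructor
  · rintro ⟨hx, hxZ⟩
    exact ⟨⟨fun hΩ => hx (subset_enl t n Ω hΩ), hxZ⟩, hx⟩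
  · rintro ⟨⟨_, hxZ⟩, hx⟩
    exact ⟨hx, hxZ⟩

/-- `(Eᶜᶜ)^{~1}` bookkeeping: `((Xᶜ)^{~n})ᶜ = X ∖ (Xᶜ)^{~n}`. [folklore] -/
private theorem compl_enl_compl_eq_diff (t n : ℕ) (X : Set (Pt d)) : (enl t n Xᶜ)ᶜ = X \ enl t n Xᶜ := by
  ext x
  simp only [Set.mem_compl_iff, Set.mem_sdiff]
  constructor
  · intro hx
    refine ⟨?_, hx⟩
    by_contra hxX
    exact hx (subset_enl t n Xᶜ hxX)
  · exact fun h => h.2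

/-- **The surrounding hypothesis for `X = Ω_jᶜ ∩ Z`, `Y = Ω_j`** (`j ≤ k`), from p. 177's class `Z`: a `t`-cube outside `X`
touching a cube of `X ⊆ Z` meets `Ω_j` — at its corner: if the corner lies in `Z` it lies in `Ω_j` (else the cube would be in
`X`); if not, it is within `t ≤ s_kR_k` of a corner in `Z`, so in `Ω_k ⊆ Ω_j` by the collar (`ClassZ.mem_of_adj`).
[cite: Balaban1989LargeFieldI, p.177] -/
theorem adj_idx_compl_inter (H : Hypotheses L M h k₀ k R Ω Z) {j t : ℕ} (hjk : j ≤ k) (ht : 0 < t)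
    (htu : t ∣ side L M k * R k) (hX : IsUnionOfCubes t ((Ω j)ᶜ ∩ Z)) :
    ∀ c, c ∉ idx t ((Ω j)ᶜ ∩ Z) → (∃ c₀ ∈ idx t ((Ω j)ᶜ ∩ Z), Touching c c₀) → c ∈ idx t (Ω j) := by
  have hL1 : 1 ≤ L := le_trans (by norm_num) H.hL
  have hu : 0 < side L M k * R k := Nat.mul_pos (side_pos hL1 H.hM k) (H.hR k)
  intro c hc ⟨c₀, hc₀, htouch⟩
  refine ⟨corner t c, ?_, cubeIdx_corner' ht c⟩
  by_contra hΩ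
  by_cases hxZ : corner t c ∈ Z
  · exact hc ⟨corner t c, ⟨hΩ, hxZ⟩, cubeIdx_corner' ht c⟩
  · have hy : corner t c₀ ∈ (Ω j)ᶜ ∩ Z := corner_mem_of_mem_idx ht hX hc₀
    have htle : (t : ℤ) ≤ (side L M k * R k : ℕ) := by exact_mod_cast Nat.le_of_dvd hu htu
    have hw : Within ((1 : ℕ) * (side L M k * R k : ℕ)) (corner t c) (corner t c₀) := by
      intro i
      have h1 := htouch i
      simp only [corner, Nat.cast_one, one_mul]
      rw [← mul_sub, abs_mul, abs_of_nonneg (Int.natCast_nonneg t)]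
      calc (t : ℤ) * |c i - c₀ i| ≤ (t : ℤ) * 1 := by gcongr
        _ ≤ _ := by simpa using htle
    have hn : IdxNear (side L M k * R k) 1 (corner t c) (corner t c₀) := idxNear_of_within _ 1 hu hw
    exact hΩ (H.Ω_antitone hjk le_rfl (H.classZ.mem_of_adj hy.2 hxZ hn))

/-- The `R`-cube sides are nested upwards: from *"R_j is the smallest number of the form Lʳ …"* ([III] (2.5)) and the flow
(2.7)–(2.8) the ratio `R_j / R_{j+1}` is `1` or `L` ([IV] p. 177: *"in some steps the number R_k decreases by the factor
L⁻¹"*), read here as `R_j ∣ L·R_{j+1}`; hence `s_jR_j ∣ s_{j+1}R_{j+1}`, and with p. 179's `L^{−N₀+1}MR_{k−N₀+1} = M`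
(`Hypotheses.hN₀`) `s_jR_j ∣ s_k` for `h < j ≤ k₀ + 1`. [cite: Balaban1988Convergent, (2.5) p.255; Balaban1989LargeFieldI, p.177, p.179] -/
theorem sideR_dvd_side_top (H : Hypotheses L M h k₀ k R Ω Z) (hRstep : ∀ j, h < j → j ≤ k₀ → R j ∣ L * R (j + 1)) :
    ∀ j, h < j → j ≤ k₀ + 1 → side L M j * R j ∣ side L M k := by
  -- descending induction from `k₀ + 1`
  suffices key : ∀ m, ∀ j, j + m = k₀ + 1 → h < j → side L M j * R j ∣ side L M k by
    intro j hj hjk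
    exact key (k₀ + 1 - j) j (by omega) hj
  intro m
  induction m with
  | zero =>
    intro j hj _
    rw [show j = k₀ + 1 by omega, H.hN₀]
  | succ m ih =>
    intro j hj hhj
    have h1 : side L M (j + 1) * R (j + 1) ∣ side L M k := ih (j + 1) (by omega) (by omega)
    have h2 : side L M j * R j ∣ side L M (j + 1) * R (j + 1) := by
      rw [side_succ]
      calc side L M j * R j ∣ side L M j * (L * R (j + 1)) := Nat.mul_dvd_mul_left _ (hRstep j hhj (by omega))
        _ = L * side L M j * R (j + 1) := by ring
    exact h2.trans h1

/-- **Regime `h < j ≤ k₀`: `Z″_j = (Ω_j^{~5})ᶜ ∩ Z` has box components** (of the `L^{−(k−j)}MR_j`-cubes, side `s_jR_j`),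
given that `Ω_jᶜ ∩ Z` has ([IV] p. 177 *"all the regions connected with the last N steps are rectangular parallelepipeds"*).
[cite: Balaban1989LargeFieldI, (1.11) p.179, p.177] -/
theorem boxComponents_zpp_mid (H : Hypotheses L M h k₀ k R Ω Z) {E : ℕ → Set (Pt d)} {j : ℕ} (hj : h < j) (hjk : j ≤ k₀)
    (hbox : BoxComponents (side L M j * R j) ((Ω j)ᶜ ∩ Z))
    (hRstep : ∀ j, h < j → j ≤ k₀ → R j ∣ L * R (j + 1)) :
    BoxComponents (side L M j * R j) (Zpp L M k₀ R Ω E Z j) := by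
  have hL1 : 1 ≤ L := le_trans (by norm_num) H.hL
  have ht : 0 < side L M j * R j := Nat.mul_pos (side_pos hL1 H.hM j) (H.hR j)
  have htu : side L M j * R j ∣ side L M k * R k :=
    (sideR_dvd_side_top H hRstep j hj (by omega)).trans (Nat.dvd_mul_right _ _)
  rw [zpp_of_le hjk, farZ_eq_diff]
  refine boxComponents_diff_enl ht hbox ?_ (adj_idx_compl_inter H (by have := H.hk; omega) ht htu hbox.1)
  exact Set.disjoint_left.mpr fun x hx hx' => hx'.1 hx

/-- **The two members of (1.10): `Z″_k = (Ω^{~5}_{k₀+1})ᶜ ∩ Z` and `Z″_{k₀+1} = (Ω^{~7}_{k₀+1})ᶜ ∩ Z` have box components** (of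
`s_k`-cubes = the `R`-cubes of scale `k₀+1`), given that `Ω_{k₀+1}ᶜ ∩ Z` has. [cite: Balaban1989LargeFieldI, (1.10) p.179, p.177] -/
theorem boxComponents_farZ_top (H : Hypotheses L M h k₀ k R Ω Z) (n : ℕ)
    (hbox : BoxComponents (side L M (k₀ + 1) * R (k₀ + 1)) ((Ω (k₀ + 1))ᶜ ∩ Z)) :
    BoxComponents (side L M k) (farZ (side L M k) n (Ω (k₀ + 1)) Z) := by
  have hL1 : 1 ≤ L := le_trans (by norm_num) H.hL
  have ht : 0 < side L M k := side_pos hL1 H.hM k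
  rw [H.hN₀] at hbox
  rw [farZ_eq_diff]
  refine boxComponents_diff_enl ht hbox ?_
    (adj_idx_compl_inter H (by have := H.hk; omega) ht (Nat.dvd_mul_right _ _) hbox.1)
  exact Set.disjoint_left.mpr fun x hx hx' => hx'.1 hx

/-- **Regime `k₀ < j ≤ k` (the completion of (1.10), `B15Eq112Admissible.completion`): `Z″_j` has box components of
`s_j`-cubes** — `Z″_k` by the previous theorem, then downwards each `Z″_j = Z″_{j+1} ∖ (Z″ᶜ_{j+1})^{~1}` (one layer of
`s_{j+1}`-cubes) by the core with `Y = Z″ᶜ_{j+1}`, refined from `s_{j+1} = L·s_j` to `s_j`; the bottom member `Z″_{k₀+1}`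
again by the previous theorem. [cite: Balaban1989LargeFieldI, (1.10) p.179] -/
theorem boxComponents_zpp_high (H : Hypotheses L M h k₀ k R Ω Z)
    (hbox : BoxComponents (side L M (k₀ + 1) * R (k₀ + 1)) ((Ω (k₀ + 1))ᶜ ∩ Z)) :
    ∀ j, k₀ < j → j ≤ k →
      BoxComponents (side L M j) (Zpp L M k₀ R Ω (completion L M k₀ k (Ω (k₀ + 1)) Z) Z j) := by
  have hL1 : 1 ≤ L := le_trans (by norm_num) H.hL
  have hL0 : 0 < L := by omega
  have hk := H.hk
  -- the bottom member
  have hbot : BoxComponents (side L M (k₀ + 1)) (Zpp L M k₀ R Ω (completion L M k₀ k (Ω (k₀ + 1)) Z) Z (k₀ + 1)) := by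
    rw [zpp_of_lt (by omega), completion_bot, compl_compl, Zk0]
    refine BoxComponents.of_mul (m := L ^ (k - (k₀ + 1))) (side_pos hL1 H.hM _) (Nat.pow_pos hL0) ?_
    rw [← side_eq_side_mul (show k₀ + 1 ≤ k by omega)]
    exact boxComponents_farZ_top H 7 hbox
  -- descending induction from the top member over `j = k - m`, `k₀ + 1 < j`
  have hdesc : ∀ m, k₀ + 1 < k - m →
      BoxComponents (side L M (k - m)) (Zpp L M k₀ R Ω (completion L M k₀ k (Ω (k₀ + 1)) Z) Z (k - m)) := by
    intro m
    induction m with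
    | zero =>
      intro _
      rw [Nat.sub_zero, zpp_of_lt (by omega), completion_top (by omega), compl_compl, Zk]
      exact boxComponents_farZ_top H 5 hbox
    | succ m ih =>
      intro hm
      have ih' := ih (by omega)
      obtain ⟨j, hj⟩ : ∃ j, j = k - (m + 1) := ⟨_, rfl⟩
      have hjm : k - m = j + 1 := by omega
      rw [hjm] at ih'
      rw [← hj]
      -- `Z″_j = ((Z″ᶜ_{j+1})^{~1})ᶜ = Z″_{j+1} ∖ (Z″ᶜ_{j+1})^{~1}` (one layer of `s_{j+1}`-cubes)
      have hZ : Zpp L M k₀ R Ω (completion L M k₀ k (Ω (k₀ + 1)) Z) Z j =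
          Zpp L M k₀ R Ω (completion L M k₀ k (Ω (k₀ + 1)) Z) Z (j + 1) \
            enl (side L M (j + 1)) 1 (Zpp L M k₀ R Ω (completion L M k₀ k (Ω (k₀ + 1)) Z) Z (j + 1))ᶜ := by
        rw [zpp_of_lt (show k₀ < j by omega), completion_mid (show k₀ + 1 < j by omega) (show j < k by omega)]
        rw [show completion L M k₀ k (Ω (k₀ + 1)) Z (j + 1) =
            (Zpp L M k₀ R Ω (completion L M k₀ k (Ω (k₀ + 1)) Z) Z (j + 1))ᶜ from by
              rw [zpp_of_lt (show k₀ < j + 1 by omega), compl_compl]]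
        exact compl_enl_compl_eq_diff _ _ _
      rw [hZ]
      refine BoxComponents.of_mul (m := L) (side_pos hL1 H.hM j) hL0 ?_
      rw [show side L M j * L = side L M (j + 1) by rw [side_succ, mul_comm]]
      exact boxComponents_diff_enl_compl (n := 1) (side_pos hL1 H.hM (j + 1)) ih'
  intro j hj hjk
  by_cases hj1 : j = k₀ + 1
  · subst hj1; exact hbot
  · have := hdesc (k - j) (by omega)
    rwa [show k - (k - j) = j by omega] at this

/-- **[IV] p. 179: «By the definition all components of the domains Z″_j are also rectangular parallelepipeds for
j = h, h + 1, …, k»** — PROVED for the new large-field regions `Z″_j`, `h < j ≤ k`, of (1.10)–(1.11) on the ℤᵈ cube carrier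
(`B15Eq112Admissible.Zpp` with the constructed completion of (1.10)), as boxes of the M-cubes `s_j = LʲM` of the
corresponding scales, from: the standing located hypotheses `B15Eq112Admissible.Hypotheses` of (1.12); the p. 177 input
`hbox` — inside the class `Z`, the old regions `Ω_jᶜ ∩ Z`, `h < j ≤ k₀ + 1`, have all their components rectangular
parallelepipeds of `L^{−(k−j)}MR_j`-cubes (*"According to our rule of construction of the large field regions, for such a
component all the regions connected with the last N steps are rectangular parallelepipeds"*, the rule being [III] p. 251 /
p. 269 with the condition (2.3) p. 255, pv02's `B14BoxFix`); and `hRstep` — `R_j ∣ L·R_{j+1}` ([III] (2.5), p. 177).  The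
member `j = h` (`Z″_h = Z_h`, an OLD region) is the input itself and is not a value of `Zpp`.
[cite: Balaban1989LargeFieldI, (1.10)–(1.12) p.179, p.177; Balaban1988Convergent, (2.3) p.255, p.251, p.269] -/
theorem boxComponents_zpp (H : Hypotheses L M h k₀ k R Ω Z)
    (hbox : ∀ j, h < j → j ≤ k₀ + 1 → BoxComponents (side L M j * R j) ((Ω j)ᶜ ∩ Z))
    (hRstep : ∀ j, h < j → j ≤ k₀ → R j ∣ L * R (j + 1)) :
    ∀ j, h < j → j ≤ k →
      BoxComponents (side L M j) (Zpp L M k₀ R Ω (completion L M k₀ k (Ω (k₀ + 1)) Z) Z j) := by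
  have hL1 : 1 ≤ L := le_trans (by norm_num) H.hL
  intro j hj hjk
  by_cases hjk₀ : j ≤ k₀
  · exact BoxComponents.of_mul (side_pos hL1 H.hM j) (H.hR j)
      (boxComponents_zpp_mid H hj hjk₀ (hbox j hj (by omega)) hRstep)
  · exact boxComponents_zpp_high H (hbox (k₀ + 1) (by have := H.hhk; omega) le_rfl) j (by omega) hjk

/-- The same in the coarser currency print uses for `h < j ≤ k₀`: the components of `Z″_j = (Ω_j^{~5})ᶜ ∩ Z` are rectangular
parallelepipeds of the `L^{−(k−j)}MR_j`-cubes themselves. [cite: Balaban1989LargeFieldI, (1.11) p.179, p.177] -/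
theorem boxComponents_zpp_Rcubes (H : Hypotheses L M h k₀ k R Ω Z) {E : ℕ → Set (Pt d)}
    (hbox : ∀ j, h < j → j ≤ k₀ + 1 → BoxComponents (side L M j * R j) ((Ω j)ᶜ ∩ Z))
    (hRstep : ∀ j, h < j → j ≤ k₀ → R j ∣ L * R (j + 1)) {j : ℕ} (hj : h < j) (hjk : j ≤ k₀) :
    BoxComponents (side L M j * R j) (Zpp L M k₀ R Ω E Z j) :=
  boxComponents_zpp_mid H hj hjk (hbox j hj (by omega)) hRstep

/-- Dictionary to pv02's index-level (2.3) vocabulary: a region with box components has, cube by cube, `B14BoxFix.IsBox`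
index components. [cite: Balaban1988Convergent, (2.3) p.255] -/
theorem BoxComponents.isBox_tComp {t : ℕ} (ht : 0 < t) {X : Set (Pt d)} (hX : BoxComponents t X) {a : Pt d} (ha : a ∈ X) :
    IsBox (tComp (idx t X) (cubeIdx t a)) := by
  obtain ⟨lo, hi, h⟩ := hX.2 a ha
  exact ⟨lo, hi, tComp_idx_of_pComp ht ha h⟩

end Main

/-! ## §7. A `d = 1` instance: `Hypotheses`, `hbox`, `hRstep` hold jointly with `Z ≠ ∅` and a non-empty middle-regime
`Z″₁` (non-vacuity of §6 in all three regimes) -/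

section Instance

/-- A point of `ℤ¹`. [folklore] -/
private def pt1 (a : ℤ) : Pt 1 := fun _ => a

/-- The old domains of the instance (`L = 2`, `M = 1`, `h = 0`, `k₀ = 2`, `k = 4`; `s_j = 2ʲ`): `Ω₀ = ℤ`,
`Ω₁ = {x < 208} ∪ {x ≥ 1392}`, `Ω₂ = {x < 144} ∪ {x ≥ 1456}`, `Ω₃ = {x < 16} ∪ {x ≥ 1584}`, `Ω₄ = {x < 0} ∪ {x ≥ 1600}`
(and `Ω_j = Ω₄` above). [folklore] -/
private def ΩI (j : ℕ) : Set (Pt 1) :=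
  if j = 0 then Set.univ else if j = 1 then {x | x 0 < 208 ∨ 1392 ≤ x 0} else if j = 2 then {x | x 0 < 144 ∨ 1456 ≤ x 0}
  else if j = 3 then {x | x 0 < 16 ∨ 1584 ≤ x 0} else {x | x 0 < 0 ∨ 1600 ≤ x 0}

/-- The component `Z = [0, 1600)` = `Ω₄ᶜ` of the instance. [folklore] -/
private def ZI : Set (Pt 1) := {x | 0 ≤ x 0 ∧ x 0 < 1600}

/-- `R₁ = 4`, `R₂ = R₃ = 2` (so that `L³MR₃ = L⁴M`), all other `R_j = 1`; `R_j ∣ L·R_{j+1}`. [folklore] -/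
private def RI (j : ℕ) : ℕ := if j = 1 then 4 else if j = 2 then 2 else if j = 3 then 2 else 1

/-- In `ℤ¹` the cube index is the floor quotient of the only coordinate. [folklore] -/
private theorem cubeIdx_eq_iff (s : ℕ) (x y : Pt 1) : cubeIdx s x = cubeIdx s y ↔ x 0 / (s : ℤ) = y 0 / (s : ℤ) := by
  constructor
  · intro h; exact congrFun h 0
  · intro h; funext i; fin_cases i; exact h

/-- The standing hypotheses of (1.12) hold for the instance. [cite: Balaban1989LargeFieldI, (1.10)–(1.12) p.179] -/
private theorem hypotheses_I : Hypotheses 2 1 0 2 4 RI ΩI ZI := by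
  refine ⟨le_rfl, le_rfl, fun j => by unfold RI; split_ifs <;> omega, by norm_num, by norm_num,
    by simp [side, RI], ⟨?_, ?_⟩, ?_, ⟨?_, ?_⟩⟩
  · -- cubes of `Ω_j`
    intro j hj x y hxy
    rw [cubeIdx_eq_iff] at hxy
    unfold ΩI
    interval_cases j <;> simp [side] at hxy ⊢ <;> omega
  · -- separation of `Ω_j`
    intro j hj x hx y hy
    have hy0 := abs_le.mp (hy 0)
    unfold ΩI at hx ⊢
    interval_cases j <;> simp [side] at hx hy0 ⊢ <;> omega
  · -- the eight-layer margin inside `Z`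
    rintro j hj hj2 x ⟨hxZ, ⟨y, hy, hn⟩⟩
    have h0 := abs_le.mp (hn 0)
    unfold ΩI at hy ⊢
    simp only [ZI, Set.mem_setOf_eq] at hxZ
    interval_cases j <;> simp [side, RI, cubeIdx] at hy h0 ⊢ <;> omega
  · -- `Z` is a union of `16`-cubes
    intro x y hxy
    rw [cubeIdx_eq_iff] at hxy
    simp only [side, RI] at hxy
    norm_num at hxy
    simp only [ZI, Set.mem_setOf_eq]
    omega
  · -- closedness: `Ω₄ᶜ = Z`
    intro x y _ hx _
    simp only [ΩI, ZI, Set.mem_setOf_eq] at hx ⊢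
    norm_num at hx
    omega

/-- A box of cubes has box components (it is ONE component: *"the smallest convex domain, which is a union of … cubes"*).
[cite: Balaban1988Convergent, p.251] -/
theorem boxComponents_cubeBox {t : ℕ} (ht : 0 < t) (lo hi : Pt d) : BoxComponents t (cubeBox t lo hi) :=
  ⟨isUnionOfCubes_cubeBox t lo hi, fun _ ha =>
    ⟨lo, hi, Set.Subset.antisymm (pComp_subset ha) fun _ hy => pconn_cubeBox ht ha hy⟩⟩

/-- The p. 177 input for the instance: `Ω₁ᶜ ∩ Z = [208, 1392)` = the `8`-cubes `26 … 173`, `Ω₂ᶜ ∩ Z = [144, 1456)` = the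
`8`-cubes `18 … 181`, `Ω₃ᶜ ∩ Z = [16, 1584)` = the `16`-cubes `1 … 98`. [cite: Balaban1989LargeFieldI, p.177] -/
private theorem hbox_I : ∀ j, 0 < j → j ≤ 2 + 1 → BoxComponents (side 2 1 j * RI j) ((ΩI j)ᶜ ∩ ZI) := by
  have key : ∀ (t : ℕ) (a b lo hi : ℤ), 0 < t → a = t * lo → b = t * (hi + 1) →
      ({x : Pt 1 | x 0 < a ∨ b ≤ x 0}ᶜ ∩ ZI ∩ {x | 0 ≤ a ∧ b ≤ 1600} = cubeBox t (pt1 lo) (pt1 hi) ∩ {x | 0 ≤ a ∧ b ≤ 1600}) := by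
    intro t a b lo hi ht ha hb
    ext x
    simp only [ZI, cubeBox, ibox, pt1, cubeIdx, Set.mem_inter_iff, Set.mem_compl_iff, Set.mem_setOf_eq, not_or, not_lt,
      not_le]
    have ht' : (0 : ℤ) < t := by exact_mod_cast ht
    constructor
    · rintro ⟨⟨⟨h1, h2⟩, h3, h4⟩, h5⟩
      refine ⟨fun i => ?_, h5⟩
      obtain rfl : i = 0 := Subsingleton.elim _ _
      constructor
      · rw [Int.le_ediv_iff_mul_le ht']; linarith
      · rw [← Int.lt_add_one_iff, Int.ediv_lt_iff_lt_mul ht']; linarith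
    · rintro ⟨h, h5⟩
      obtain ⟨h1, h2⟩ := h 0
      rw [Int.le_ediv_iff_mul_le ht'] at h1
      rw [← Int.lt_add_one_iff, Int.ediv_lt_iff_lt_mul ht'] at h2
      refine ⟨⟨⟨by linarith, by linarith⟩, by linarith, by linarith⟩, h5⟩
  have use : ∀ (t : ℕ) (a b lo hi : ℤ), 0 < t → a = t * lo → b = t * (hi + 1) → 0 ≤ a → b ≤ 1600 →
      BoxComponents t ({x : Pt 1 | x 0 < a ∨ b ≤ x 0}ᶜ ∩ ZI) := by
    intro t a b lo hi ht ha hb h0 h1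
    have e := key t a b lo hi ht ha hb
    rw [show ({x : Pt 1 | 0 ≤ a ∧ b ≤ 1600}) = Set.univ from Set.eq_univ_of_forall fun _ => ⟨h0, h1⟩,
      Set.inter_univ, Set.inter_univ] at e
    rw [e]
    exact boxComponents_cubeBox ht _ _
  intro j hj hj2
  interval_cases j
  · simpa [ΩI, side, RI] using use 8 208 1392 26 173 (by norm_num) (by norm_num) (by norm_num) (by norm_num) (by norm_num)
  · simpa [ΩI, side, RI] using use 8 144 1456 18 181 (by norm_num) (by norm_num) (by norm_num) (by norm_num) (by norm_num)
  · simpa [ΩI, side, RI] using use 16 16 1584 1 98 (by norm_num) (by norm_num) (by norm_num) (by norm_num) (by norm_num)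

/-- **Non-vacuity of §6.**  For the `d = 1` data above ALL hypotheses of `boxComponents_zpp` hold (`Hypotheses`, the p. 177
input `hbox`, the R-flow input `hRstep`), `Z ≠ ∅`, and the middle-regime region `Z″₁ = (Ω₁^{~5})ᶜ ∩ Z` (five layers of
`L^{−3}MR₁`-cubes of side `8`) is non-empty — so the printed clause is established for a non-degenerate configuration:
every `Z″_j`, `0 < j ≤ 4`, has all its components rectangular parallelepipeds of `s_j`-cubes.
[cite: Balaban1989LargeFieldI, (1.10)–(1.12) p.179, p.177] -/
theorem instance_boxComponents_zpp :
    Hypotheses 2 1 0 2 4 RI ΩI ZI ∧ ZI.Nonempty ∧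
      (Zpp 2 1 2 RI ΩI (completion 2 1 2 4 (ΩI 3) ZI) ZI 1).Nonempty ∧
      ∀ j, 0 < j → j ≤ 4 → BoxComponents (side 2 1 j) (Zpp 2 1 2 RI ΩI (completion 2 1 2 4 (ΩI 3) ZI) ZI j) := by
  have hRstep : ∀ j, 0 < j → j ≤ 2 → RI j ∣ 2 * RI (j + 1) := by
    intro j hj hj1
    interval_cases j <;> simp [RI]
  refine ⟨hypotheses_I, ⟨pt1 0, by simp [ZI, pt1]⟩, ⟨pt1 800, ?_⟩, boxComponents_zpp hypotheses_I hbox_I hRstep⟩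
  rw [zpp_of_le (L := 2) (M := 1) (k₀ := 2) (R := RI) (Ω := ΩI) (E := completion 2 1 2 4 (ΩI 3) ZI) (Z := ZI)
    (j := 1) (by norm_num)]
  refine ⟨?_, by simp [ZI, pt1]⟩
  rintro ⟨y, hy, hn⟩
  have h0 := abs_le.mp (hn 0)
  simp only [ΩI, cubeIdx, pt1, side, RI] at hy h0
  norm_num at hy h0
  omega

end Instance

end Literature.MathematicalPhysics.QuantumFieldTheory.Balaban1983to89.B15Eq112Parallelepipeds
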